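import Summits.RiemannHypothesis.RiemannHypothesis.Theorems.SignConeCondRungTent

/-!
# Route SignCone — conditional rungs, II: the B-spline mollifier `crMoll h m`

Support for the conditional rung theorem (items stmt-RiemannHypothesis-16301/16302). The mollifier is the
`(m+1)`-fold convolution power of the tent `crTent h` (`SignConeCondRungTent`): continuous, compactly supported in
`[-2(m+1)h, 2(m+1)h]`, with Mellin transform `sinhc((s-½)h)^{2(m+1)}` (`weilMellin_weilConv_holds`); on the
critical line this is `sinc(yh)^{2(m+1)} ∈ [0, 1]` with `1 - sinc(u)^{2(m+1)} ≤ (m+1)u²/3` (`|u| ≤ 1`), and in the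
strip `‖(crMoll h m)^(β+iγ)‖ ≤ (cosh((β-½)h)/(|γ|h))^{2(m+1)}` — the flatness and the decay that make the
low/high-frequency split of the conditional rung theorem work.
-/

noncomputable section

-- `Summit.RiemannHypothesis.RiemannHypothesis.…` repeats a namespace component by design (D-0017 layout).
set_option linter.dupNamespace false

open scoped BigOperators ComplexConjugate Real Topology
open Complex MeasureTheory Set Filter

namespace Summit.RiemannHypothesis.RiemannHypothesis.Theorems.SignCone

open Literature.NumberTheory.LFunctions

variable {h : ℝ}

/-! ### The mollifier: convolution powers of the tent -/

/-- `crMoll h m` — the `(m+1)`-fold convolution power of the tent `crTent h` (a B-spline: continuous,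
support `[-2(m+1)h, 2(m+1)h]`, Mellin transform `sinhc((s-½)h)^{2(m+1)}`). [folklore] -/
def crMoll (h : ℝ) : ℕ → ℝ → ℂ
  | 0 => crTent h
  | m + 1 => weilConv (crMoll h m) (crTent h)

section Moll

variable (hh : 0 < h)
include hh

/-- Continuity and compact support of `crMoll h m`. [folklore] -/
theorem continuous_hasCompactSupport_crMoll :
    ∀ m : ℕ, Continuous (crMoll h m) ∧ HasCompactSupport (crMoll h m)
  | 0 => ⟨continuous_crTent h, hasCompactSupport_crTent hh⟩
  | m + 1 => by
    obtain ⟨hc, hs⟩ := continuous_hasCompactSupport_crMoll m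
    refine ⟨?_, ?_⟩
    · show Continuous (weilConv (crMoll h m) (crTent h))
      rw [weilConv_eq_convolution_real]
      exact (hasCompactSupport_crTent hh).continuous_convolution_right _
        hc.locallyIntegrable (continuous_crTent h)
    · show HasCompactSupport (weilConv (crMoll h m) (crTent h))
      rw [weilConv_eq_convolution_real]
      exact hs.convolution _ (hasCompactSupport_crTent hh)

/-- `crMoll h m` is continuous. [folklore] -/
theorem continuous_crMoll (m : ℕ) : Continuous (crMoll h m) := (continuous_hasCompactSupport_crMoll hh m).1
/-- `crMoll h m` has compact support. [folklore] -/
theorem hasCompactSupport_crMoll (m : ℕ) : HasCompactSupport (crMoll h m) :=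
  (continuous_hasCompactSupport_crMoll hh m).2

/-- `tsupport (crMoll h m) ⊆ [-2(m+1)h, 2(m+1)h]`. [folklore] -/
theorem tsupport_crMoll_subset :
    ∀ m : ℕ, tsupport (crMoll h m) ⊆ Icc (-(2 * (m + 1) * h)) (2 * (m + 1) * h)
  | 0 => by
    show tsupport (crTent h) ⊆ _
    simpa using tsupport_crTent_subset hh
  | m + 1 => by
    show tsupport (weilConv (crMoll h m) (crTent h)) ⊆ _
    refine (tsupport_weilConv_subset (hasCompactSupport_crMoll hh m)).trans ?_
    rintro x ⟨u, hu, v, hv, rfl⟩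
    have hu' := tsupport_crMoll_subset m hu
    have hv' := tsupport_crTent_subset hh hv
    simp only [mem_Icc] at hu' hv' ⊢
    push_cast
    constructor <;> nlinarith

/-- **Mellin transform of the mollifier**: `(crMoll h m)^(s) = sinhc((s - ½)h)^{2(m+1)}`. [folklore] -/
theorem weilMellin_crMoll (s : ℂ) : ∀ m : ℕ, weilMellin (crMoll h m) s = sinhc ((s - 1 / 2) * h) ^ (2 * (m + 1))
  | 0 => by
    show weilMellin (crTent h) s = _
    simpa using weilMellin_crTent hh s
  | m + 1 => by
    show weilMellin (weilConv (crMoll h m) (crTent h)) s = _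
    rw [weilMellin_weilConv_holds (continuous_crMoll hh m) (hasCompactSupport_crMoll hh m)
      (continuous_crTent h) (hasCompactSupport_crTent hh), weilMellin_crMoll s m, weilMellin_crTent hh s]
    ring

/-- On the critical line the transform is a power of `sinc`: `(crMoll h m)^(½ + iy) = sinc(yh)^{2(m+1)}`. [folklore] -/
theorem weilMellin_crMoll_half_line (y : ℝ) (m : ℕ) :
    weilMellin (crMoll h m) (1 / 2 + y * I) = ((Real.sinc (y * h) ^ (2 * (m + 1)) : ℝ) : ℂ) := by
  rw [weilMellin_crMoll hh, show ((1 / 2 : ℂ) + y * I - 1 / 2) * h = ((y * h : ℝ) : ℂ) * I by push_cast; ring,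
    sinhc_mul_I]
  push_cast
  ring

/-- `‖(crMoll h m)^(½ + iy)‖ = sinc(yh)^{2(m+1)} ≤ 1`. [folklore] -/
theorem norm_weilMellin_crMoll_half_line (y : ℝ) (m : ℕ) :
    ‖weilMellin (crMoll h m) (1 / 2 + y * I)‖ = Real.sinc (y * h) ^ (2 * (m + 1)) ∧
      Real.sinc (y * h) ^ (2 * (m + 1)) ≤ 1 := by
  have hp : 0 ≤ Real.sinc (y * h) ^ (2 * (m + 1)) := by rw [pow_mul]; positivity
  refine ⟨?_, ?_⟩
  · rw [weilMellin_crMoll_half_line hh, Complex.norm_real, Real.norm_eq_abs, abs_of_nonneg hp]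
  · rw [pow_mul]
    refine pow_le_one₀ (sq_nonneg _) ?_
    rw [sq_le_one_iff_abs_le_one]
    exact Real.abs_sinc_le_one _

omit hh in
/-- Flatness near the origin: `1 - sinc(u)^{2(m+1)} ≤ (m+1) u² / 3` for `|u| ≤ 1`
(from `u - u³/6 < sin u` for `u > 0`). [folklore] -/
theorem one_sub_sinc_pow_le {u : ℝ} (hu : |u| ≤ 1) (m : ℕ) :
    1 - Real.sinc u ^ (2 * (m + 1)) ≤ (m + 1) * u ^ 2 / 3 := by
  -- sinc u ≥ 1 - u²/6 (all u), ≥ 0 for |u| ≤ 1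
  have key : ∀ v : ℝ, 0 ≤ v → 1 - v ^ 2 / 6 ≤ Real.sinc v := by
    intro v hv0
    rcases hv0.eq_or_lt with rfl | hv
    · simp
    · rw [Real.sinc_of_ne_zero hv.ne', le_div_iff₀ hv]
      nlinarith [Real.sin_gt_sub_cube hv]
  have hs : 1 - u ^ 2 / 6 ≤ Real.sinc u := by
    rcases le_or_gt 0 u with h0 | h0
    · exact key u h0
    · have := key (-u) (by linarith)
      rwa [Real.sinc_neg, neg_sq] at this
  have hu2 : u ^ 2 ≤ 1 := by
    have := abs_le.1 hu
    nlinarith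
  have hs0 : 0 ≤ Real.sinc u := by linarith
  have hs1 : Real.sinc u ≤ 1 := Real.sinc_le_one u
  -- Bernoulli: 1 - x^n ≤ n (1 - x) for 0 ≤ x ≤ 1
  have bern : ∀ (n : ℕ) (x : ℝ), 0 ≤ x → x ≤ 1 → 1 - x ^ n ≤ n * (1 - x) := by
    intro n x hx0 hx1
    have := one_add_mul_le_pow (show (-2 : ℝ) ≤ x - 1 by linarith) n
    rw [add_sub_cancel] at this
    linarith
  have h1 := bern (2 * (m + 1)) (Real.sinc u) hs0 hs1
  push_cast at h1
  nlinarith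

/-- Off the line: `‖(crMoll h m)^(β + iγ)‖ ≤ (cosh((β-½)h) / (|γ| h))^{2(m+1)}` for `γ ≠ 0`. [folklore] -/
theorem norm_weilMellin_crMoll_le {β γ : ℝ} (hγ : γ ≠ 0) (m : ℕ) :
    ‖weilMellin (crMoll h m) (β + γ * I)‖ ≤ (Real.cosh ((β - 1 / 2) * h) / (|γ| * h)) ^ (2 * (m + 1)) := by
  rw [weilMellin_crMoll hh, norm_pow]
  have hw : ((β + γ * I - 1 / 2) * h : ℂ) = (((β - 1 / 2) * h : ℝ) : ℂ) + ((γ * h : ℝ) : ℂ) * I := by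
    push_cast; ring
  have hre : ((β + γ * I - 1 / 2) * h : ℂ).re = (β - 1 / 2) * h := by
    rw [hw, Complex.add_re, Complex.ofReal_re, Complex.re_ofReal_mul, Complex.I_re, mul_zero, add_zero]
  have him : ((β + γ * I - 1 / 2) * h : ℂ).im = γ * h := by
    rw [hw, Complex.add_im, Complex.ofReal_im, Complex.im_ofReal_mul, Complex.I_im, mul_one, zero_add]
  have hb := norm_sinhc_le (w := (β + γ * I - 1 / 2) * h) (by rw [him]; exact mul_ne_zero hγ hh.ne')
  rw [hre, him, abs_mul, abs_of_pos hh] at hb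
  exact pow_le_pow_left₀ (norm_nonneg _) hb _

end Moll

end Summit.RiemannHypothesis.RiemannHypothesis.Theorems.SignCone

end
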